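import Summits.ResolutionOfSingularities.ResolutionOfSingularities.Theorems.WeightedInvariantWeightedThesisFBlowupExists
import Literature.AlgebraicGeometry.Resolution.BlowupsScaling
import Literature.AlgebraicGeometry.Resolution.BlowupsProperProofs
import Literature.AlgebraicGeometry.Resolution.ProperModels
import Mathlib.AlgebraicGeometry.Limits
import HarnessLib

/-!
# Gluing the blowing ups of a scalar-compatible family of ideals — `stub_datumBlowup`

Crux `SyzygyFlattening.Globalisation` (stmt-ResolutionOfSingularities-17061), line `birth`,
registered stub `stub_datumBlowup`. On an integral scheme `X` (the underlying scheme `M.X` of a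
proper model) let `N U ⊆ Γ(X, U)` be an ideal for every affine open `U`, nonzero for nonempty `U`,
and compatible up to nonzero scalars under restriction to smaller nonempty affine opens `V ⊆ U`:
`a · N V = b · (N U) Γ(X, V)` for some nonzero `a, b ∈ Γ(X, V)`. There is no ideal SHEAF in
general, but isomorphic fractional ideals have the same blowing up (Villamayor 2006, proof of
Thm. 3.3; `isBlowup_iff_of_span_singleton_mul_eq`, `BlowupsScaling.lean`), so the affine blowing
ups `Bl_{N U}(Spec Γ(X, U)) → Spec Γ(X, U) ≅ U` still form a relative gluing datum over the
locally directed cover of `X` by its affine opens and glue — exactly as in the existence proof of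
blowing ups (Görtz–Wedhorn I, Prop. 13.92; `BlowupsExistence.exists_isBlowup`, whose proof is
followed line by line with the ideal sheaf `J|_U` replaced by the family `K U = Ñ_U` moved along
`U ≅ Spec Γ(X, U)`).

* `isBlowup_of_isEmpty` — over an empty scheme every morphism is a blowing up (empty opens);
  the bookkeeping "`Ñ_V` moved to `V` pulls back along `U ↪ V` to `(N_V Γ(X, U))~` moved to `U`"
  is `WeightedThesis.KunzTower.comap_idealSheaf_homOfLE` (landed with the F-blowup gluing of the
  route `WeightedThesis`, `…FBlowupExists.lean`, which follows the same pattern);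
* `isBlowup_toBase_restrict` — the glued morphism of a relative gluing datum of blowing ups
  restricts over the affine open `U` to a blowing up (both it and the datum's `U`-th member are
  the preimage of `U`);
* `exists_forall_isBlowup_of_compatible` — **the gluing**: `∃ π : Y → X` whose restriction over
  every affine open `U`, read through `U ≅ Spec Γ(X, U)`, is a blowing up along `Ñ_U`;
* `isIntegral_of_isIntegral_preimage_affineOpens`, `isIntegral_of_forall_isBlowup` — `Y` is
  integral (each `π⁻¹(U)` is a blowing up of the integral `Spec Γ(X, U)` along a nonzero ideal
  sheaf, Stacks 02ND = `IsBlowup.isIntegral`; any two such charts contain a third);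
* `isProper_of_forall_isBlowup` — `π` is proper (`X` locally Noetherian; properness is local on the
  base and blowing ups of Noetherian schemes are proper, Stacks 02NS = `IsBlowup.isProper`);
* `stub_datumBlowup` — the registered statement, for the scheme of a proper model.

Sources: U. Görtz, T. Wedhorn, *Algebraic Geometry I*, 2nd ed. (2020), Prop. 13.91, 13.92;
O. Villamayor U., J. Algebra 295 (2006), proof of Thm. 3.3 and 3.4; The Stacks Project,
Tags 01LH, 02ND, 02NS.
-/

noncomputable section

-- single-problem summit: the doubled namespace component `ResolutionOfSingularities` is forced
set_option linter.dupNamespace false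

namespace Summit.ResolutionOfSingularities.ResolutionOfSingularities.Theorems.SyzygyFlattening

open CategoryTheory CategoryTheory.Limits AlgebraicGeometry TopologicalSpace
open Literature.AlgebraicGeometry
open Literature.AlgebraicGeometry.Resolution
open Summit.ResolutionOfSingularities.ResolutionOfSingularities.Theorems.WeightedThesis.KunzTower
  (comap_idealSheaf_homOfLE)

universe u

/-! ## Bookkeeping -/

/-- Over an empty scheme every morphism is a blowing up along every ideal sheaf: the source is
empty too, so the exceptional locus is vacuously effective Cartier and every test scheme is empty,
i.e. initial. [folklore] -/
theorem isBlowup_of_isEmpty {B U : Scheme.{u}} [IsEmpty U] (p : B ⟶ U) (K : U.IdealSheafData) :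
    IsBlowup p K := by
  haveI : IsEmpty B := p.base.hom.1.isEmpty
  refine ⟨fun x => isEmptyElim x, fun W f _ => ?_⟩
  haveI : IsEmpty W := f.base.hom.1.isEmpty
  exact ⟨isInitialOfIsEmpty.to B, isInitialOfIsEmpty.hom_ext _ _,
    fun g _ => isInitialOfIsEmpty.hom_ext _ _⟩

/-- **The glued morphism restricts over `U` to a blowing up** (the per-open form of
`IsBlowup.toBase_of_relativeGluingData`): if the `U`-th member `d_U : X'_U → U` of a relative
gluing datum over the locally directed affine cover is a blowing up of `U` along `K`, so is the
restriction of the glued `d.toBase : X' → X` over `U` — both squares `X'_U → X' → X ← U` and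
`toBase⁻¹(U) → X' → X ← U` are cartesian (Mathlib's `RelativeGluingData.isPullback_natTrans_ι_toBase`,
`isPullback_morphismRestrict`), and blowing ups transport along isomorphisms of the source.
[cite: GortzWedhorn2020, Prop. 13.92 (proof)] -/
theorem isBlowup_toBase_restrict {X : Scheme.{u}} (d : X.directedAffineCover.RelativeGluingData)
    (U : X.affineOpens) {K : ((U : X.Opens) : Scheme.{u}).IdealSheafData}
    (hd : IsBlowup (d.natTrans.app U) K) : IsBlowup (d.toBase ∣_ (U : X.Opens)) K := by
  have sq1 : IsPullback (d.natTrans.app U) (colimit.ι d.functor U) (U : X.Opens).ι d.toBase :=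
    d.isPullback_natTrans_ι_toBase U
  have sq2 := isPullback_morphismRestrict d.toBase (U : X.Opens)
  have hφ : (sq1.isoIsPullback _ _ sq2).inv ≫ d.natTrans.app U = d.toBase ∣_ (U : X.Opens) :=
    sq1.isoIsPullback_inv_fst _ _ sq2
  have := hd.iso_comp (sq1.isoIsPullback _ _ sq2).symm
  rwa [Iso.symm_hom, hφ] at this

/-! ## The gluing -/

/-- **Gluing the affine blowing ups of a scalar-compatible family of ideals** (the proof of
Görtz–Wedhorn I, Prop. 13.92 = `BlowupsExistence.exists_isBlowup`, with the scaling lemma of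
Villamayor 2006, proof of Thm. 3.3, supplying the compatibility): on an integral scheme `X`, ideals
`N U ⊆ Γ(X, U)` (`U` affine open), nonzero for nonempty `U` and with `a · N V = b · (N U) Γ(X, V)`
for nonzero `a, b` whenever `V ⊆ U` and `V` is nonempty, admit a morphism `π : Y → X` whose
restriction over EVERY affine open `U`, through `U ≅ Spec Γ(X, U)`, is a blowing up along `Ñ_U`.
Relative gluing (Stacks 01LH, Mathlib `Scheme.Cover.RelativeGluingData`) of the affine blowing ups
`Bl_{N U}(Spec Γ(X, U)) → U` (`affineBlowup.isBlowup`): for `U ⊆ V` the blowing up of `U` along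
`Ñ_U` is one along `(N_V Γ(X, U))~ = Ñ_V|_U` (`isBlowup_iff_of_span_singleton_mul_eq`; empty `U`
trivially), whence cartesian transition maps (`IsBlowup.isPullback_of_isOpenImmersion`).
[cite: GortzWedhorn2020, Prop. 13.92] -/
theorem exists_forall_isBlowup_of_compatible {X : Scheme.{u}} [IsIntegral X]
    (N : ∀ U : X.affineOpens, Ideal Γ(X, U))
    (hN : ∀ U : X.affineOpens, ((U : X.Opens) : Set X).Nonempty → N U ≠ ⊥)
    (hc : ∀ (U V : X.affineOpens) (hVU : (V : X.Opens) ≤ (U : X.Opens)),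
      ((V : X.Opens) : Set X).Nonempty →
      ∃ a b : Γ(X, V), a ≠ 0 ∧ b ≠ 0 ∧
        Ideal.span {a} * N V =
          Ideal.span {b} * (N U).map (X.presheaf.map (homOfLE hVU).op).hom) :
    ∃ (Y : Scheme.{u}) (π : Y ⟶ X), ∀ U : X.affineOpens,
      IsBlowup (π ∣_ (U : X.Opens) ≫ U.2.isoSpec.hom) (affineBlowup.idealSheaf (N U)) := by
  classical
  -- the ideal sheaves `K U = Ñ_U` moved to the affine opens `U`
  obtain ⟨K, hK⟩ : ∃ K : ∀ U : X.affineOpens, ((U : X.Opens) : Scheme.{u}).IdealSheafData,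
      ∀ U, K U = (affineBlowup.idealSheaf (N U)).comap U.2.isoSpec.hom := ⟨_, fun _ => rfl⟩
  -- local blowing ups `Bl_{N U}(Spec Γ(X, U)) → U` of `U` along `K U`; KEY (scaling lemma): they
  -- are also blowing ups of `U` along `K V|_U` for every affine open `V ⊇ U`
  have hloc : ∀ U : X.affineOpens, ∃ (B : Scheme.{u}) (p : B ⟶ (U : X.Opens)),
      IsBlowup p (K U) ∧ ∀ (V : X.affineOpens) (h : U ≤ V),
        IsBlowup p ((K V).comap (X.homOfLE h)) := by
    intro U
    refine ⟨affineBlowup (N U), affineBlowup.π (N U) ≫ U.2.isoSpec.inv, ?_, fun V h => ?_⟩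
    · rw [hK]
      exact (affineBlowup.isBlowup (N U)).comp_iso U.2.isoSpec.symm
    · rw [hK, comap_idealSheaf_homOfLE h (N V)]
      rcases ((U : X.Opens) : Set X).eq_empty_or_nonempty with hU | hU
      · -- `U = ∅`: everything over `U` is empty
        haveI : IsEmpty (U : X.Opens) :=
          ⟨fun x => (Set.eq_empty_iff_forall_notMem.mp hU) _ x.2⟩
        exact isBlowup_of_isEmpty _ _
      · haveI : Nonempty (U : X.Opens) := by
          obtain ⟨x, hx⟩ := hU
          exact ⟨⟨x, hx⟩⟩
        obtain ⟨a, b, ha, hb, hab⟩ := hc V U h hU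
        have h1 := (isBlowup_iff_of_span_singleton_mul_eq (π := affineBlowup.π (N U)) (hN U hU)
          hb ha hab.symm).mp (affineBlowup.isBlowup (N U))
        exact h1.comp_iso U.2.isoSpec.symm
  choose B p hp hkey using hloc
  -- the Cartier condition producing the transition morphisms `Bl(U) → Bl(V)` for `U ≤ V`
  have hcart : ∀ {U V : X.affineOpens} (h : U ≤ V),
      IsEffectiveCartier ((K V).comap (p U ≫ X.homOfLE h)) := by
    intro U V h
    rw [Scheme.IdealSheafData.comap_comp]
    exact (hkey U V h).isEffectiveCartier
  let 𝒰 := X.directedAffineCover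
  -- the functor of local blowing ups over the locally directed affine cover
  let F : 𝒰.I₀ ⥤ Scheme.{u} :=
    { obj := fun U => B U
      map := fun {U V} f => (hp V).lift (p U ≫ X.homOfLE f.le) (hcart f.le)
      map_id := fun U => by
        refine (hp U).hom_ext ?_ ?_
        · rw [(hp U).lift_comp]; exact hcart le_rfl
        · rw [(hp U).lift_comp, Category.id_comp, Scheme.homOfLE_rfl, Category.comp_id]
      map_comp := fun {U V W} f g => by
        refine (hp W).hom_ext ?_ ?_
        · rw [(hp W).lift_comp]; exact hcart _
        · rw [(hp W).lift_comp, Category.assoc, (hp W).lift_comp, ← Category.assoc,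
            (hp V).lift_comp, Category.assoc, Scheme.homOfLE_homOfLE] }
  -- the structure maps, a cartesian natural transformation
  let α : F ⟶ 𝒰.functorOfLocallyDirected :=
    { app := fun U => p U
      naturality := fun {U V} f => by
        change (hp V).lift (p U ≫ X.homOfLE f.le) (hcart f.le) ≫ p V = p U ≫ X.homOfLE f.le
        rw [(hp V).lift_comp] }
  have hα : NatTrans.Equifibered α := by
    intro U V f
    change IsPullback ((hp V).lift (p U ≫ X.homOfLE f.le) (hcart f.le)) (p U) (p V)
      (X.homOfLE f.le)
    exact (hp V).isPullback_of_isOpenImmersion (X.homOfLE f.le) (hkey U V f.le)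
      ((hp V).lift_comp _ _)
  let d : 𝒰.RelativeGluingData := ⟨F, α, hα⟩
  refine ⟨d.glued, d.toBase, fun U => ?_⟩
  -- over `U` the glued morphism is a blowing up along `K U`, i.e. along `Ñ_U` after `U ≅ Spec`
  have h1 : IsBlowup (d.toBase ∣_ (U : X.Opens)) (K U) := isBlowup_toBase_restrict d U (hp U)
  have e2 : (K U).comap U.2.isoSpec.inv = affineBlowup.idealSheaf (N U) := by
    rw [hK, ← Scheme.IdealSheafData.comap_comp, Iso.inv_hom_id, Scheme.IdealSheafData.comap_id]
  have h2 := h1.comp_iso U.2.isoSpec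
  rw [e2] at h2
  exact h2

/-! ## Integrality and properness are local over the nonempty affine opens -/

/-- A scheme `Y` over an integral scheme `X` is integral as soon as the preimages `π⁻¹(U)` of the
nonempty affine opens `U ⊆ X` are integral schemes: `Y` is reduced because every stalk is a stalk
of some `π⁻¹(U)`, and irreducible because the `π⁻¹(U)` are irreducible opens any two of which
contain a third (the preimage of a nonempty affine open inside `U₁ ∩ U₂ ≠ ∅`, `X` irreducible).
(The argument of `IsModuleBlowup.isIntegral`.) [folklore] -/
theorem isIntegral_of_isIntegral_preimage_affineOpens {Y X : Scheme.{u}} [IsIntegral X]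
    (π : Y ⟶ X) (hint : ∀ U : X.affineOpens, ((U : X.Opens) : Set X).Nonempty →
      IsIntegral (π ⁻¹ᵁ (U : X.Opens) : Scheme.{u})) : IsIntegral Y := by
  have hchart : ∀ y : Y, ∃ U : X.affineOpens, π y ∈ (U : X.Opens) := fun y => by
    obtain ⟨W, hW, hxW, -⟩ :=
      exists_isAffineOpen_mem_and_subset (X := X) (x := π y) (U := ⊤) (Opens.mem_top _)
    exact ⟨⟨W, hW⟩, hxW⟩
  have hirr : ∀ U : X.affineOpens, ((U : X.Opens) : Set X).Nonempty →
      IsIrreducible ((π ⁻¹ᵁ (U : X.Opens) : Y.Opens) : Set Y) := fun U hU => by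
    haveI := hint U hU
    have : ((π ⁻¹ᵁ (U : X.Opens) : Y.Opens) : Set Y) = (π ⁻¹ᵁ (U : X.Opens)).ι '' Set.univ := by
      rw [Set.image_univ, Scheme.Opens.range_ι]
    rw [this]
    exact (IrreducibleSpace.isIrreducible_univ _).image _ (Scheme.Hom.continuous _).continuousOn
  -- reduced
  haveI : IsReduced Y := by
    haveI : ∀ y : Y, _root_.IsReduced (Y.presheaf.stalk y) := fun y => by
      obtain ⟨U, hyU⟩ := hchart y
      haveI := hint U ⟨π y, hyU⟩
      let V : Y.Opens := π ⁻¹ᵁ (U : X.Opens)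
      let y' : V := ⟨y, hyU⟩
      let i := (V.stalkIso y').commRingCatIsoToRingEquiv
      exact isReduced_of_injective i.symm.toRingHom i.symm.injective
    exact isReduced_of_isReduced_stalk Y
  -- irreducible
  haveI : IrreducibleSpace Y := by
    obtain ⟨x⟩ := (inferInstance : Nonempty X)
    obtain ⟨W₀, hW₀, hxW₀, -⟩ :=
      exists_isAffineOpen_mem_and_subset (X := X) (x := x) (U := ⊤) (Opens.mem_top _)
    let U₀ : X.affineOpens := ⟨W₀, hW₀⟩
    haveI := hint U₀ ⟨x, hxW₀⟩
    obtain ⟨y₀⟩ := (inferInstance : Nonempty (π ⁻¹ᵁ (U₀ : X.Opens) : Scheme.{u}))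
    haveI : Nonempty Y := ⟨y₀.1⟩
    haveI : PreirreducibleSpace Y := by
      refine ⟨fun u v hu hv hu' hv' => ?_⟩
      obtain ⟨y₁, -, hy₁⟩ := hu'
      obtain ⟨y₂, -, hy₂⟩ := hv'
      obtain ⟨U₁, h₁⟩ := hchart y₁
      obtain ⟨U₂, h₂⟩ := hchart y₂
      obtain ⟨x₃, hx₃⟩ := nonempty_preirreducible_inter (U₁ : X.Opens).2 (U₂ : X.Opens).2
        ⟨π y₁, h₁⟩ ⟨π y₂, h₂⟩
      obtain ⟨W, hW, hxW, hWle⟩ := exists_isAffineOpen_mem_and_subset (X := X) (x := x₃)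
        (U := (U₁ : X.Opens) ⊓ (U₂ : X.Opens)) hx₃
      let U₃ : X.affineOpens := ⟨W, hW⟩
      have hV₁ := (hirr U₁ ⟨π y₁, h₁⟩).isPreirreducible
      have hV₂ := (hirr U₂ ⟨π y₂, h₂⟩).isPreirreducible
      have hV₃ := (hirr U₃ ⟨x₃, hxW⟩).nonempty
      have h31 : ((π ⁻¹ᵁ (U₃ : X.Opens) : Y.Opens) : Set Y) ⊆ (π ⁻¹ᵁ (U₁ : X.Opens) : Y.Opens) :=
        fun z hz => (hWle hz).1
      have h32 : ((π ⁻¹ᵁ (U₃ : X.Opens) : Y.Opens) : Set Y) ⊆ (π ⁻¹ᵁ (U₂ : X.Opens) : Y.Opens) :=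
        fun z hz => (hWle hz).2
      obtain ⟨z, -, hzu, hz₃⟩ := hV₁ u _ hu (π ⁻¹ᵁ (U₃ : X.Opens)).2 ⟨y₁, h₁, hy₁⟩
        (by obtain ⟨w, hw⟩ := hV₃; exact ⟨w, h31 hw, hw⟩)
      obtain ⟨t, -, ⟨htu, -⟩, htv⟩ := hV₂ _ v (hu.inter (π ⁻¹ᵁ (U₃ : X.Opens)).2) hv
        ⟨z, h32 hz₃, hzu, hz₃⟩ ⟨y₂, h₂, hy₂⟩
      exact ⟨t, Set.mem_univ t, htu, htv⟩
    exact ⟨inferInstance⟩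
  exact isIntegral_of_irreducibleSpace_of_isReduced Y

/-- **The glued blowing up of an integral scheme along nonzero ideals is integral**: over a
nonempty affine open `U` it is a blowing up of the integral `Spec Γ(X, U)` along the nonzero
`Ñ_U`, hence `π⁻¹(U)` is integral (Stacks 02ND, `IsBlowup.isIntegral`), and
`isIntegral_of_isIntegral_preimage_affineOpens`. [cite: StacksProject, Tag 02ND] -/
theorem isIntegral_of_forall_isBlowup {Y X : Scheme.{u}} [IsIntegral X] {π : Y ⟶ X}
    (N : ∀ U : X.affineOpens, Ideal Γ(X, U))
    (hN : ∀ U : X.affineOpens, ((U : X.Opens) : Set X).Nonempty → N U ≠ ⊥)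
    (hπ : ∀ U : X.affineOpens, ((U : X.Opens) : Set X).Nonempty →
      IsBlowup (π ∣_ (U : X.Opens) ≫ U.2.isoSpec.hom) (affineBlowup.idealSheaf (N U))) :
    IsIntegral Y := by
  refine isIntegral_of_isIntegral_preimage_affineOpens π fun U hU => ?_
  haveI : Nonempty (U : X.Opens) := by
    obtain ⟨x, hx⟩ := hU
    exact ⟨⟨x, hx⟩⟩
  exact (hπ U hU).isIntegral (affineBlowup.idealSheaf_ne_bot (hN U hU))

/-- **The glued blowing up of a locally Noetherian scheme is proper**: properness is local on the
base, the nonempty affine opens cover, and over a nonempty affine open `U ≅ Spec Γ(X, U)` the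
morphism is a blowing up of a Noetherian affine scheme, proper by Stacks 02NS
(`IsBlowup.isProper`). (The argument of `IsModuleBlowup.isProper`.)
[cite: StacksProject, Tag 02NS] -/
theorem isProper_of_forall_isBlowup {Y X : Scheme.{u}} [IsLocallyNoetherian X] {π : Y ⟶ X}
    (N : ∀ U : X.affineOpens, Ideal Γ(X, U))
    (hπ : ∀ U : X.affineOpens, ((U : X.Opens) : Set X).Nonempty →
      IsBlowup (π ∣_ (U : X.Opens) ≫ U.2.isoSpec.hom) (affineBlowup.idealSheaf (N U))) :
    IsProper π := by
  refine IsZariskiLocalAtTarget.of_iSup_eq_top (P := @IsProper)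
    (fun U : {U : X.affineOpens // ((U : X.Opens) : Set X).Nonempty} => (U.1 : X.Opens)) ?_
    fun U => ?_
  · rw [eq_top_iff]
    rintro x -
    obtain ⟨W, hW, hxW, -⟩ :=
      exists_isAffineOpen_mem_and_subset (X := X) (x := x) (U := ⊤) (Opens.mem_top _)
    exact Opens.mem_iSup.mpr ⟨⟨⟨W, hW⟩, ⟨x, hxW⟩⟩, hxW⟩
  · obtain ⟨U, hU⟩ := U
    haveI : IsNoetherianRing Γ(X, U) := IsLocallyNoetherian.component_noetherian U
    have h1 : IsProper (π ∣_ (U : X.Opens) ≫ U.2.isoSpec.hom) := (hπ U hU).isProper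
    exact (MorphismProperty.cancel_right_of_respectsIso @IsProper _ _).mp h1

/-! ## The registered statement -/

/-- **STUB `stub_datumBlowup` (generic gluing of affine blow-ups).** On a proper model `M`, ideals
`N_U ⊆ Γ(M, U)` on the affine opens, non-zero on non-empty `U` and compatible up to non-zero scalars
under restriction to smaller affine opens (`a · N_V = b · N_U Γ(M, V)` for `V ⊆ U`), admit a blowing
up: `π : Y → M` with `Y` integral, `π` proper, and `π` restricted over every non-empty affine open
`U ≅ Spec Γ(M, U)` a blowing up along `Ñ_U` (`IsBlowup`). Proof: `exists_forall_isBlowup_of_compatible`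
(relative gluing over the locally directed affine cover as in `BlowupsExistence.exists_isBlowup`,
with `isBlowup_iff_of_span_singleton_mul_eq` — isomorphic fractional ideals have the same blow-up —
supplying the transition maps), `isIntegral_of_forall_isBlowup` (Stacks 02ND chartwise) and
`isProper_of_forall_isBlowup` (Stacks 02NS chartwise).
[cite: GortzWedhorn2020, Prop. 13.92; Villamayoru2006, 3.4] -/
theorem stub_datumBlowup : ∀ (k K : Type) [Field k] [Field K] [Algebra k K]
    (M : ProperModel k K) (N : ∀ U : M.X.affineOpens, Ideal Γ(M.X, U)),
      (∀ U : M.X.affineOpens, ((U : M.X.Opens) : Set M.X).Nonempty → N U ≠ ⊥) →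
      (∀ (U V : M.X.affineOpens) (hVU : (V : M.X.Opens) ≤ (U : M.X.Opens)),
        ((V : M.X.Opens) : Set M.X).Nonempty →
        ∃ a b : Γ(M.X, V), a ≠ 0 ∧ b ≠ 0 ∧
          Ideal.span {a} * N V =
            Ideal.span {b} * (N U).map (M.X.presheaf.map (homOfLE hVU).op).hom) →
      ∃ (Y : Scheme.{0}) (π : Y ⟶ M.X), IsIntegral Y ∧ IsProper π ∧
        ∀ U : M.X.affineOpens, ((U : M.X.Opens) : Set M.X).Nonempty →
          IsBlowup (π ∣_ (U : M.X.Opens) ≫ U.2.isoSpec.hom) (affineBlowup.idealSheaf (N U)) := by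
  intro k K _ _ _ M N hN hc
  obtain ⟨Y, π, hπ⟩ := exists_forall_isBlowup_of_compatible N hN hc
  exact ⟨Y, π, isIntegral_of_forall_isBlowup N hN fun U _ => hπ U,
    isProper_of_forall_isBlowup N fun U _ => hπ U, fun U _ => hπ U⟩

end Summit.ResolutionOfSingularities.ResolutionOfSingularities.Theorems.SyzygyFlattening

end
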